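import Summits.AtomisticToContinuum.BoseEinsteinCondensation.Theorems.BlockLatticeFSumBlockCondensation

/-!
# The block floor F♭ for DIRICHLET states in any larger cell (zero-extension step of MF «BoxMixedFloor», decomp-a2c hand-2 g8)

`CellNBudgetBlockFloor` (F♭, PROVED: `BlockCondensation.cellNBudgetBlockFloor_holds`, hand-1 g9 p818958 on hand-2's engine p817973) speaks
about `C¹` Bose-symmetric functions normalised on a fundamental cell `[0,L')^{3N}` with the PLAIN cell energy.  A Dirichlet trial state
`Ψ : TrialState N L` of the open box `(0,L)^{3N}` is such a function for EVERY `L' ≥ L` (zero-extension: its support lies in the box, so its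
normalisation and occupations are unchanged by the cell indicator and its cell energy is at most its energy).  Hence:

* `dirichletBudgetBlockFloor` : for every repulsive finite-range `v`, `A > 0`, `η > 0` there are `ρ₀, τ > 0`, `N₀` such that for all
  `N ≥ N₀`, `0 < L ≤ L'`... (precisely: `0 < L'`, `L ≤ L'`), `N ≤ ρ₀ L'³`, every Dirichlet state `Ψ : TrialState N L` with
  `energy v Ψ ≤ (4πa + τ)(N/L'³)N` has `∑_q ⟨u_q, γ_Ψ u_q⟩ ≥ (1−η)N` over the `K³` sub-cell modes of side `L'/K` of the LARGER cell, for every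
  even `K > 0` with `L'/K` in the window `[A, 2A]/√(N/L'³)` — the «zero-extend to a cell of side `(K+2)L/K` or `(K+4)L/K`» step of lens-6 g29's
  MF (`BoxLatticeFSumCarving.BoxMixedFloor`, shift class `s = 0`), leaving to MF's prover only the Dyson budget and the window/density
  bookkeeping between `ρ = N/L³` and `ρ' = N/L'³`.
Helpers: `boxN_subset_cellN`, `indicator_cellN_trialState`, `setLIntegral_cellN_normSq_trialState`, `setLIntegral_cellN_energy_le`.
`[folklore]` / [LSSY2005, Thm 5.1]; no definitions, no `sorry`.
-/

noncomputable section

open MeasureTheory Set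
open scoped ENNReal NNReal BigOperators

namespace Summit.AtomisticToContinuum.BoseEinsteinCondensation.Theorems.BlockLatticeFSumDirichletFloor

open Literature.MathematicalPhysics.QuantumManyBody.BoseGas
open Summit.AtomisticToContinuum.BoseEinsteinCondensation.Theorems.BlockCondensation (cellNBudgetBlockFloor_holds)

variable {N : ℕ} {L L' : ℝ}

/-- The open box of side `L` lies in the fundamental cell of any side `L' ≥ L`. [folklore] -/
theorem boxN_subset_cellN (h : L ≤ L') : boxN N L ⊆ cellN N L' := by
  intro X hX i k
  have hk := hX i k
  exact ⟨hk.1.le, hk.2.trans_le h⟩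

/-- A Dirichlet state is unchanged by the indicator of any larger cell. [folklore] -/
theorem indicator_cellN_trialState (Ψ : TrialState N L) (h : L ≤ L') : (cellN N L').indicator Ψ.ψ = Ψ.ψ := by
  funext X
  by_cases hX : X ∈ cellN N L'
  · exact Set.indicator_of_mem hX _
  · rw [Set.indicator_of_notMem hX, Ψ.eq_zero X fun hb => hX (boxN_subset_cellN h hb)]

/-- A Dirichlet state is normalised on any larger cell. [folklore] -/
theorem setLIntegral_cellN_normSq_trialState (Ψ : TrialState N L) (h : L ≤ L') :
    ∫⁻ X in cellN N L', (‖Ψ.ψ X‖₊ : ℝ≥0∞) ^ 2 = 1 := by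
  rw [setLIntegral_eq_of_support_subset]
  · exact Ψ.norm_eq
  · intro X hX
    by_contra hXc
    exact hX (by simp [Ψ.eq_zero X fun hb => hXc (boxN_subset_cellN h hb)])

/-- The plain cell energy of a Dirichlet state is at most its energy. [folklore] -/
theorem setLIntegral_cellN_energy_le (v : ℝ → ℝ≥0∞) (Ψ : TrialState N L) (L' : ℝ) :
    ∫⁻ X in cellN N L', kineticDensity Ψ.ψ X + interaction v X * (‖Ψ.ψ X‖₊ : ℝ≥0∞) ^ 2 ≤ energy v Ψ :=
  setLIntegral_le_lintegral _ _

/-- **F♭ for Dirichlet states in any larger cell** (the zero-extension step of MF): box-uniform sub-cell floor for Dirichlet trial states of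
`(0,L)^{3N}` read in a cell `[0,L')^{3N}`, `L' ≥ L`, under the plain budget `(4πa + τ)(N/L'³)N`, at every even block number `K` with `L'/K` in
the GP window of the density `N/L'³`. [cite: LSSY2005, Thm. 5.1 (5.15)–(5.17); folklore (zero extension)] -/
theorem dirichletBudgetBlockFloor :
    ∀ v : ℝ → ℝ≥0∞, IsRepulsiveFiniteRange v → ∀ A : ℝ, 0 < A → ∀ η : ℝ, 0 < η →
      ∃ ρ₀ : ℝ, 0 < ρ₀ ∧ ∃ τ : ℝ, 0 < τ ∧ ∃ N₀ : ℕ, ∀ (N : ℕ) (L L' : ℝ), 0 < L' → L ≤ L' → N₀ ≤ N →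
        (N : ℝ) ≤ ρ₀ * L' ^ 3 → ∀ Ψ : TrialState N L,
          energy v Ψ ≤ ENNReal.ofReal ((4 * Real.pi * (scatteringLength v).toReal + τ) * ((N : ℝ) / L' ^ 3) * N) →
          ∀ K : ℕ, Even K → 0 < K →
            A / Real.sqrt ((N : ℝ) / L' ^ 3) ≤ L' / (K : ℝ) ∧ L' / (K : ℝ) ≤ 2 * A / Real.sqrt ((N : ℝ) / L' ^ 3) →
            ENNReal.ofReal ((1 - η) * N) ≤ ∑ q : SubIdx K, occupation N (subMode (L' / (K : ℝ)) q) Ψ.ψ := by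
  intro v hv A hA η hη
  obtain ⟨ρ₀, hρ₀, τ, hτ, N₀, H⟩ := cellNBudgetBlockFloor_holds v hv A hA η hη
  refine ⟨ρ₀, hρ₀, τ, hτ, N₀, ?_⟩
  intro N L L' hL' hLL' hN hNρ Ψ hE K hK hK0 hwin
  have h := H N L' hL' hN hNρ Ψ.ψ Ψ.contDiff Ψ.symm (setLIntegral_cellN_normSq_trialState Ψ hLL')
    ((setLIntegral_cellN_energy_le v Ψ L').trans hE) K hK hK0 hwin
  rwa [indicator_cellN_trialState Ψ hLL'] at h

end Summit.AtomisticToContinuum.BoseEinsteinCondensation.Theorems.BlockLatticeFSumDirichletFloor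

end
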